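import Mathlib.NumberTheory.LSeries.Nonvanishing
import Mathlib.NumberTheory.LSeries.Positivity
import HarnessLib

/-!
# Non-negativity of the coefficients of `ζ(s) L(s,χ₁) L(s,χ₂) L(s,χ₁χ₂)` (Montgomery–Vaughan p. 285)

Topic: `Literature/NumberTheory/LFunctions`. Second supporting file for the discharge of the named
fact `Literature.NumberTheory.LFunctions.siegel_lower_bound` (`RHWave0.lean`, rh.S34; Siegel 1935), following
Montgomery–Vaughan, *Multiplicative Number Theory I*, proof of Thm. 11.14 (p. 285): for quadratic
characters `χ₁ mod q₁`, `χ₂ mod q₂`, "the Dirichlet series coefficients of `ζ(s) f(s)`",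
`f(s) = L(s, χ₁) L(s, χ₂) L(s, χ₁χ₂)`, "are non-negative". MV read this off
`log ζ(s) f(s) = ∑ Λ(n)/log n · (1 + χ₁(n))(1 + χ₂(n)) n^{-s}`; we give the equivalent
multiplicative proof, avoiding logarithms of Dirichlet series: the coefficient sequence
`r = ζ ⋆ χ₁ ⋆ χ₂ ⋆ χ₁χ₂` is multiplicative, and at a prime power `p^k` one of the two groupings
`r = (ζ ⋆ χ₁) ⋆ (χ₂ · (ζ ⋆ χ₁))`, `r = (ζ ⋆ χ₂) ⋆ (χ₁ · (ζ ⋆ χ₂))` (twisting by a character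
distributes over Dirichlet convolution) exhibits `r(p^k)` as a sum of non-negative terms, using
Mathlib's `DirichletCharacter.zetaMul_nonneg` (`ζ ⋆ χ ≥ 0` for quadratic `χ`) and, when
`χ₁(p) = χ₂(p) = -1`, `(ζ ⋆ χ₁)(p^j) = [j even]`.

## Main results

* `Literature.SiegelCoefficients.prodChar χ₁ χ₂` — the character `χ₁χ₂ mod q₁q₂` and its values
  `prodChar χ₁ χ₂ n = χ₁ n * χ₂ n` on `ℕ` (`prodChar_apply_natCast`);
* `Literature.SiegelCoefficients.coeff χ₁ χ₂` — the arithmetic function `ζ ⋆ χ₁ ⋆ χ₂ ⋆ χ₁χ₂`;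
  `coeff_nonneg` (`r(n) ≥ 0`), `coeff_apply_one` (`r(1) = 1`);
* `Literature.NumberTheory.LFunctions.SiegelCoefficients.LSeries_coeff_eq` — for `Re s > 1`,
  `∑ r(n) n^{-s} = ζ(s) L(s, χ₁) L(s, χ₂) L(s, χ₁χ₂)`, with summability
  (`LSeriesSummable_coeff`, `abscissaOfAbsConv_coeff_le_one`).

## References

* H. L. Montgomery, R. C. Vaughan, *Multiplicative Number Theory I. Classical Theory*,
  Cambridge 2007, §11.2, proof of Thm. 11.14, p. 285.

## Design choices

* Non-negativity of complex numbers is Mathlib's scoped `ComplexOrder` (`0 ≤ z ↔ 0 ≤ z.re ∧ z.im = 0`),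
  as in `Mathlib.NumberTheory.LSeries.Positivity`.
* `χ₁χ₂` is realised at level `q₁ q₂` (`changeLevel` of both factors), not at the conductor; its
  `L`-function then differs from the primitive one by finitely many Euler factors, which is
  harmless for Siegel's theorem and keeps `prodChar_apply_natCast` an identity on all of `ℕ`.
-/

noncomputable section

open Complex ArithmeticFunction Finset
open scoped ComplexOrder LSeries.notation

namespace Literature.NumberTheory.LFunctions.SiegelCoefficients

variable {q₁ q₂ : ℕ} (χ₁ : DirichletCharacter ℂ q₁) (χ₂ : DirichletCharacter ℂ q₂)

/-! ### The product character -/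

/-- The character `χ₁ χ₂` to the modulus `q₁ q₂` (both factors lifted by `changeLevel`).
[cite: MontgomeryVaughan2007, §11.2 proof of Thm. 11.14, p. 285] -/
def prodChar : DirichletCharacter ℂ (q₁ * q₂) :=
  DirichletCharacter.changeLevel (dvd_mul_right q₁ q₂) χ₁ *
    DirichletCharacter.changeLevel (dvd_mul_left q₂ q₁) χ₂

/-- On natural numbers, `(χ₁χ₂)(n) = χ₁(n) χ₂(n)` (both sides vanish unless `n` is coprime to
`q₁ q₂`). [folklore] -/
theorem prodChar_apply_natCast (n : ℕ) :
    prodChar χ₁ χ₂ (n : ZMod (q₁ * q₂)) = χ₁ (n : ZMod q₁) * χ₂ (n : ZMod q₂) := by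
  by_cases h : n.Coprime (q₁ * q₂)
  · have h' : IsCoprime (n : ℤ) ((q₁ * q₂ : ℕ) : ℤ) := Nat.isCoprime_iff_coprime.mpr h
    have e1 := DirichletCharacter.changeLevel_eq_cast_of_dvd' χ₁ (dvd_mul_right q₁ q₂) h'
    have e2 := DirichletCharacter.changeLevel_eq_cast_of_dvd' χ₂ (dvd_mul_left q₂ q₁) h'
    simp only [Int.cast_natCast] at e1 e2
    rw [prodChar, MulChar.mul_apply, e1, e2]
  · have h0 : ¬ IsUnit (n : ZMod (q₁ * q₂)) := mt (ZMod.isUnit_iff_coprime n (q₁ * q₂)).mp h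
    rw [MulChar.map_nonunit _ h0]
    have : ¬ (n.Coprime q₁ ∧ n.Coprime q₂) := fun hh => h (Nat.Coprime.mul_right hh.1 hh.2)
    rcases not_and_or.mp this with h1 | h2
    · rw [MulChar.map_nonunit _ (mt (ZMod.isUnit_iff_coprime n q₁).mp h1), zero_mul]
    · rw [MulChar.map_nonunit _ (mt (ZMod.isUnit_iff_coprime n q₂).mp h2), mul_zero]

/-- The product of two quadratic characters is quadratic. [folklore] -/
theorem prodChar_sq_eq_one (h₁ : χ₁ ^ 2 = 1) (h₂ : χ₂ ^ 2 = 1) : prodChar χ₁ χ₂ ^ 2 = 1 := by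
  rw [prodChar, mul_pow, ← map_pow, ← map_pow, h₁, h₂, map_one, map_one, one_mul]

/-! ### The coefficient sequence -/

/-- `χ` as an arithmetic function (value `0` at `0`). [folklore] -/
abbrev charAF {q : ℕ} (χ : DirichletCharacter ℂ q) : ArithmeticFunction ℂ :=
  toArithmeticFunction (χ ·)

/-- `χ₁ χ₂` as an arithmetic function: the pointwise product. [folklore] -/
abbrev prodAF : ArithmeticFunction ℂ := (charAF χ₁).pmul (charAF χ₂)

/-- The coefficient sequence `r = ζ ⋆ χ₁ ⋆ χ₂ ⋆ χ₁χ₂` of `ζ(s) L(s,χ₁) L(s,χ₂) L(s,χ₁χ₂)`,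
grouped as `(ζ ⋆ χ₁) ⋆ (χ₂ ⋆ χ₁χ₂)`. [cite: MontgomeryVaughan2007, §11.2 proof of Thm. 11.14, p. 285] -/
def coeff : ArithmeticFunction ℂ := χ₁.zetaMul * (charAF χ₂ * prodAF χ₁ χ₂)

/-- `prodAF` agrees with `prodChar` away from `0`. [folklore] -/
lemma prodAF_apply {n : ℕ} (hn : n ≠ 0) : prodAF χ₁ χ₂ n = χ₁ (n : ZMod q₁) * χ₂ (n : ZMod q₂) := by
  simp [prodAF, charAF, pmul_apply, toArithmeticFunction, hn]

/-- Twisting distributes over convolution: `χ₂ ⋆ (χ₁χ₂) = χ₂ · (ζ ⋆ χ₁)` pointwise. [folklore] -/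
lemma charAF_mul_prodAF : charAF χ₂ * prodAF χ₁ χ₂ = (charAF χ₂).pmul χ₁.zetaMul := by
  ext n
  rcases eq_or_ne n 0 with rfl | hn
  · simp
  rw [pmul_apply, DirichletCharacter.zetaMul, coe_zeta_mul_apply, mul_apply, mul_sum,
    Nat.sum_divisorsAntidiagonal' (fun a b => charAF χ₂ a * prodAF χ₁ χ₂ b)]
  refine sum_congr rfl fun i hi => ?_
  have hi0 : i ≠ 0 := (Nat.pos_of_mem_divisors hi).ne'
  have hdvd : i ∣ n := Nat.dvd_of_mem_divisors hi
  have hni0 : n / i ≠ 0 := (Nat.div_pos (Nat.le_of_dvd (Nat.pos_of_ne_zero hn) hdvd)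
    (Nat.pos_of_ne_zero hi0)).ne'
  rw [prodAF_apply χ₁ χ₂ hi0]
  simp only [charAF, toArithmeticFunction, coe_mk, hni0, ↓reduceIte, hi0, hn]
  have : χ₂ (n : ZMod q₂) = χ₂ ((n / i : ℕ) : ZMod q₂) * χ₂ (i : ZMod q₂) := by
    rw [← map_mul, ← Nat.cast_mul, Nat.div_mul_cancel hdvd]
  rw [this]
  ring

/-- The symmetric grouping: `χ₁ ⋆ (χ₁χ₂) = χ₁ · (ζ ⋆ χ₂)`. [folklore] -/
lemma charAF_mul_prodAF' : charAF χ₁ * prodAF χ₁ χ₂ = (charAF χ₁).pmul χ₂.zetaMul := by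
  have h : prodAF χ₁ χ₂ = prodAF χ₂ χ₁ := pmul_comm _ _
  rw [h]
  exact charAF_mul_prodAF χ₂ χ₁

/-- `r = (ζ ⋆ χ₂) ⋆ (χ₁ ⋆ χ₁χ₂)` as well. [folklore] -/
lemma coeff_eq' : coeff χ₁ χ₂ = χ₂.zetaMul * (charAF χ₁ * prodAF χ₁ χ₂) := by
  unfold coeff DirichletCharacter.zetaMul
  simp only [charAF]
  ring

/-- `r` is multiplicative. [folklore] -/
lemma isMultiplicative_coeff : (coeff χ₁ χ₂).IsMultiplicative :=
  χ₁.isMultiplicative_zetaMul.mul <| (DirichletCharacter.isMultiplicative_toArithmeticFunction χ₂).mul <|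
    (DirichletCharacter.isMultiplicative_toArithmeticFunction χ₁).pmul
      (DirichletCharacter.isMultiplicative_toArithmeticFunction χ₂)

/-- `r(1) = 1`. [cite: MontgomeryVaughan2007, §11.2 Lemma 11.13 hypothesis `r(1) = 1`] -/
theorem coeff_apply_one : coeff χ₁ χ₂ 1 = 1 := (isMultiplicative_coeff χ₁ χ₂).map_one

/-! ### Non-negativity at prime powers -/

/-- If `f ≥ 0` everywhere and `g ≥ 0` on the powers of a prime `p`, then `(f ⋆ g)(p^k) ≥ 0`. [folklore] -/
lemma mul_prime_pow_nonneg {f g : ArithmeticFunction ℂ} (hf : ∀ n, 0 ≤ f n) {p : ℕ} (hp : p.Prime)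
    (hg : ∀ j : ℕ, 0 ≤ g (p ^ j)) (k : ℕ) : 0 ≤ (f * g) (p ^ k) := by
  rw [mul_apply]
  refine sum_nonneg fun x hx => ?_
  obtain ⟨hx1, -⟩ := Nat.mem_divisorsAntidiagonal.mp hx
  have hdvd : x.2 ∣ p ^ k := Dvd.intro_left _ hx1
  obtain ⟨j, -, hj⟩ := (Nat.dvd_prime_pow hp).mp hdvd
  rw [hj]
  exact mul_nonneg (hf _) (hg j)

/-- `(ζ ⋆ χ)(p^j) = ∑_{i ≤ j} χ(p)^i`. [folklore] -/
lemma zetaMul_prime_pow {q : ℕ} (χ : DirichletCharacter ℂ q) {p : ℕ} (hp : p.Prime) (j : ℕ) :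
    χ.zetaMul (p ^ j) = ∑ i ∈ range (j + 1), χ (p : ZMod q) ^ i := by
  simp only [DirichletCharacter.zetaMul, toArithmeticFunction, coe_zeta_mul_apply, coe_mk,
    Nat.sum_divisors_prime_pow hp, pow_eq_zero_iff', hp.ne_zero, ne_eq, false_and, ↓reduceIte,
    Nat.cast_pow, map_pow]

/-- First grouping: if `χ₂(p) ∈ {0, 1}` then `(χ₂ · (ζ ⋆ χ₁))(p^j) = χ₂(p)^j (ζ ⋆ χ₁)(p^j) ≥ 0`. [folklore] -/
lemma pmul_zetaMul_prime_pow_nonneg (h₁ : χ₁ ^ 2 = 1) {p : ℕ} (hp : p.Prime)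
    (h : 0 ≤ χ₂ (p : ZMod q₂)) (j : ℕ) : 0 ≤ ((charAF χ₂).pmul χ₁.zetaMul) (p ^ j) := by
  rw [pmul_apply]
  refine mul_nonneg ?_ (DirichletCharacter.zetaMul_prime_pow_nonneg h₁ hp j)
  simp only [charAF, toArithmeticFunction, coe_mk, pow_eq_zero_iff', hp.ne_zero, ne_eq, false_and,
    ↓reduceIte, Nat.cast_pow, map_pow]
  exact pow_nonneg h j

/-- The remaining case of the first grouping: if `χ₁(p) = χ₂(p) = -1` then
`(ζ ⋆ χ₁)(p^j) = [j even]`, so `(χ₂ · (ζ ⋆ χ₁))(p^j) = (-1)^j [j even] ≥ 0`. [folklore] -/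
lemma pmul_zetaMul_prime_pow_nonneg_of_neg {p : ℕ} (hp : p.Prime)
    (h1 : χ₁ (p : ZMod q₁) = -1) (h2 : χ₂ (p : ZMod q₂) = -1) (j : ℕ) :
    0 ≤ ((charAF χ₂).pmul χ₁.zetaMul) (p ^ j) := by
  rw [pmul_apply, zetaMul_prime_pow χ₁ hp, h1, neg_one_geom_sum]
  simp only [charAF, toArithmeticFunction, coe_mk, pow_eq_zero_iff', hp.ne_zero, ne_eq, false_and,
    ↓reduceIte, Nat.cast_pow, map_pow, h2]
  rcases Nat.even_or_odd j with hj | hj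
  · have : ¬ Even (j + 1) := by simpa [Nat.even_add_one] using hj
    simp [this, hj.neg_one_pow]
  · have : Even (j + 1) := hj.add_one
    simp [this]

/-- **MV p. 285**: `r(p^k) ≥ 0` for every prime power. [cite: MontgomeryVaughan2007, §11.2 proof of Thm. 11.14, p. 285] -/
theorem coeff_prime_pow_nonneg (h₁ : χ₁ ^ 2 = 1) (h₂ : χ₂ ^ 2 = 1) {p : ℕ} (hp : p.Prime)
    (k : ℕ) : 0 ≤ coeff χ₁ χ₂ (p ^ k) := by
  have hq₁ := MulChar.isQuadratic_iff_sq_eq_one.mpr h₁ (p : ZMod q₁)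
  have hq₂ := MulChar.isQuadratic_iff_sq_eq_one.mpr h₂ (p : ZMod q₂)
  -- second grouping, used when `χ₂(p) = -1` but `χ₁(p) ∈ {0, 1}`
  have caseB : 0 ≤ χ₁ (p : ZMod q₁) → 0 ≤ coeff χ₁ χ₂ (p ^ k) := fun h => by
    rw [coeff_eq', charAF_mul_prodAF']
    exact mul_prime_pow_nonneg (DirichletCharacter.zetaMul_nonneg h₂) hp
      (pmul_zetaMul_prime_pow_nonneg χ₂ χ₁ h₂ hp h) k
  -- first grouping
  have caseA : (∀ j : ℕ, 0 ≤ ((charAF χ₂).pmul χ₁.zetaMul) (p ^ j)) → 0 ≤ coeff χ₁ χ₂ (p ^ k) :=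
    fun h => by
      rw [coeff, charAF_mul_prodAF]
      exact mul_prime_pow_nonneg (DirichletCharacter.zetaMul_nonneg h₁) hp h k
  rcases hq₂ with h2 | h2 | h2
  · exact caseA (pmul_zetaMul_prime_pow_nonneg χ₁ χ₂ h₁ hp (by rw [h2]))
  · exact caseA (pmul_zetaMul_prime_pow_nonneg χ₁ χ₂ h₁ hp (by rw [h2]; exact zero_le_one))
  · rcases hq₁ with h1 | h1 | h1
    · exact caseB (by rw [h1])
    · exact caseB (by rw [h1]; exact zero_le_one)
    · exact caseA (pmul_zetaMul_prime_pow_nonneg_of_neg χ₁ χ₂ hp h1 h2)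

/-- **MV p. 285**: the coefficients of `ζ(s) L(s,χ₁) L(s,χ₂) L(s,χ₁χ₂)` are non-negative
(`χ₁`, `χ₂` quadratic). [cite: MontgomeryVaughan2007, §11.2 proof of Thm. 11.14, p. 285] -/
theorem coeff_nonneg (h₁ : χ₁ ^ 2 = 1) (h₂ : χ₂ ^ 2 = 1) (n : ℕ) : 0 ≤ coeff χ₁ χ₂ n := by
  rcases eq_or_ne n 0 with rfl | hn
  · simp only [ArithmeticFunction.map_zero, le_refl]
  · simpa only [(isMultiplicative_coeff χ₁ χ₂).multiplicative_factorization _ hn] using!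
      Finset.prod_nonneg
        fun p hp => coeff_prime_pow_nonneg χ₁ χ₂ h₁ h₂ (Nat.prime_of_mem_primeFactors hp) _

/-- Summability of `∑ χ₁χ₂(n) n^{-s}` for `Re s > 1`. [folklore] -/
lemma LSeriesSummable_prodAF {s : ℂ} (hs : 1 < s.re) : LSeriesSummable (prodAF χ₁ χ₂) s := by
  refine LSeriesSummable_of_bounded_of_one_lt_re (m := 1) (fun n hn => ?_) hs
  rw [prodAF_apply χ₁ χ₂ hn, norm_mul]
  simpa using mul_le_mul (χ₁.norm_le_one _) (χ₂.norm_le_one _) (norm_nonneg _) zero_le_one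

/-- Summability of `∑ χ(n) n^{-s}` (as an arithmetic function) for `Re s > 1`. [folklore] -/
lemma LSeriesSummable_charAF {q : ℕ} (χ : DirichletCharacter ℂ q) {s : ℂ} (hs : 1 < s.re) :
    LSeriesSummable (charAF χ) s := by
  refine LSeriesSummable_of_bounded_of_one_lt_re (m := 1) (fun n hn => ?_) hs
  simp only [charAF, toArithmeticFunction, coe_mk, hn, ↓reduceIte]
  simpa using χ.norm_le_one _

/-- **Summability**: `∑ r(n) n^{-s}` converges absolutely for `Re s > 1`. [folklore] -/
theorem LSeriesSummable_coeff {s : ℂ} (hs : 1 < s.re) : LSeriesSummable (coeff χ₁ χ₂) s :=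
  LSeriesSummable_mul (χ₁.LSeriesSummable_zetaMul hs) <|
    LSeriesSummable_mul (LSeriesSummable_charAF χ₂ hs) (LSeriesSummable_prodAF χ₁ χ₂ hs)

/-- The abscissa of absolute convergence of `∑ r(n) n^{-s}` is at most `1`. [folklore] -/
theorem abscissaOfAbsConv_coeff_le_one :
    LSeries.abscissaOfAbsConv (coeff χ₁ χ₂) ≤ (1 : ℝ) :=
  LSeries.abscissaOfAbsConv_le_of_forall_lt_LSeriesSummable fun y hy =>
    LSeriesSummable_coeff χ₁ χ₂ (by simpa using hy)

/-! ### The Dirichlet series -/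

section LSeries

variable [NeZero q₁] [NeZero q₂]

/-- `∑ (ζ ⋆ χ)(n) n^{-s} = ζ(s) L(s, χ)` for `Re s > 1`. [folklore] -/
lemma LSeries_zetaMul_eq {q : ℕ} [NeZero q] (χ : DirichletCharacter ℂ q) {s : ℂ} (hs : 1 < s.re) :
    LSeries χ.zetaMul s = riemannZeta s * χ.LFunction s := by
  rw [DirichletCharacter.zetaMul, ← ArithmeticFunction.coe_mul, LSeries_convolution']
  · rw [χ.LFunction_eq_LSeries hs]
    congr 1
    · simp_rw [← LSeries_zeta_eq_riemannZeta hs, ← natCoe_apply]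
    · exact (LSeries_congr χ.apply_eq_toArithmeticFunction_apply s).symm
  · exact LSeriesSummable_zeta_iff.mpr hs
  · exact LSeriesSummable_charAF χ hs

/-- **The Dirichlet series** `∑ r(n) n^{-s} = ζ(s) L(s, χ₁) L(s, χ₂) L(s, χ₁χ₂)` for `Re s > 1`.
[cite: MontgomeryVaughan2007, §11.2 proof of Thm. 11.14, p. 285] -/
theorem LSeries_coeff_eq {s : ℂ} (hs : 1 < s.re) :
    LSeries (coeff χ₁ χ₂) s =
      riemannZeta s * (χ₁.LFunction s * χ₂.LFunction s * (prodChar χ₁ χ₂).LFunction s) := by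
  rw [coeff, ← ArithmeticFunction.coe_mul, LSeries_convolution' (χ₁.LSeriesSummable_zetaMul hs)
    (LSeriesSummable_mul (LSeriesSummable_charAF χ₂ hs) (LSeriesSummable_prodAF χ₁ χ₂ hs)),
    LSeries_zetaMul_eq χ₁ hs, ← ArithmeticFunction.coe_mul,
    LSeries_convolution' (LSeriesSummable_charAF χ₂ hs) (LSeriesSummable_prodAF χ₁ χ₂ hs)]
  have h2 : LSeries (charAF χ₂) s = χ₂.LFunction s := by
    rw [χ₂.LFunction_eq_LSeries hs]
    exact (LSeries_congr χ₂.apply_eq_toArithmeticFunction_apply s).symm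
  have h3 : LSeries (prodAF χ₁ χ₂) s = (prodChar χ₁ χ₂).LFunction s := by
    rw [(prodChar χ₁ χ₂).LFunction_eq_LSeries hs]
    refine LSeries_congr (fun {n} hn => ?_) s
    rw [prodAF_apply χ₁ χ₂ hn, prodChar_apply_natCast]
  rw [h2, h3]
  ring

end LSeries

end Literature.NumberTheory.LFunctions.SiegelCoefficients

end
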